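import Literature.MathematicalPhysics.QuantumFieldTheory.LatticeMassGap
import Literature.Probability.LatticeModels.ONModelExistence
import Literature.Probability.LatticeModels.ONModelCovarianceDecay
import Literature.Probability.LatticeModels.ONModelSymmetry
import HarnessLib

/-!
# High-temperature mass gap of the O(N) model — proof

Sibling proof file of `Literature/MathematicalPhysics/QuantumFieldTheory/LatticeMassGap.lean`.
It discharges the named fact
`Literature.MathematicalPhysics.QuantumFieldTheory.onTwoPoint_decay_high_temperature`
(constructive-qft.S26's known counterpart; Dobrushin 1968; Georgii 2011, Thm. 8.7 with Example 8.11
and Cor. 8.32; Friedli–Velenik 2017, §6.5.2) as `onTwoPoint_decay_high_temperature_holds`, with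
the explicit threshold `β₀(d) = ¼ log (1 + 1/(2d+1))`. No definition and no named fact is
introduced (D-0026); everything here is proved, from three Literature proof files:

1. `ONModelExistence.lean` — existence of infinite-volume Gibbs measures of the O(N) model by
   compactness and the Feller property (`GibbsExistenceCompact.lean`; Friedli–Velenik 2017,
   Thm. 6.26 / §6.10.2), and uniqueness for `2d (e^{4β} - 1) < 1` by Dobrushin's criterion
   (`ONModelDobrushinStates.subsingleton_gibbsMeasures_onSpecification`, Thm. 6.31): conjunct (i).
2. `ONModelCovarianceDecay.lean` — Dobrushin's comparison estimate between the Gibbs measure and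
   its tilt by a local density: `|μ((s 0)_i (s x)_i) - μ((s 0)_i) μ((s x)_i)| ≤ 6 e^{-m‖x‖}`,
   `m = -log (2d (e^{4β} - 1)) > 0` (Georgii 2011, Thm. 8.20 / Cor. 8.32).
3. `ONModelSymmetry.lean` — `O(N)`-invariance of the unique Gibbs measure, whence `μ((s x)_i) = 0`
   (Friedli–Velenik 2017, §6.6 with §9.1).

Summing over the `N` coordinates, `|⟨s_0 · s_x⟩_μ| ≤ 6N e^{-m‖x‖}` (sup norm), i.e.
`HasExponentialDecay (x ↦ onTwoPoint μ 0 x)`: conjunct (ii). (For `d = 0` the lattice is a point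
and the statement is trivial.)

## References

* R. L. Dobrushin, Theory Probab. Appl. 13 (1968) 197–224.
* H.-O. Georgii, *Gibbs Measures and Phase Transitions*, 2nd ed. (2011), Thm. 8.7, Prop. 8.8,
  Example 8.11, Thm. 8.20, Cor. 8.32 (as cited in `LatticeMassGap.lean`; not re-read here).
* S. Friedli, Y. Velenik, *Statistical Mechanics of Lattice Systems* (CUP 2017), Thm. 6.26,
  Thm. 6.31, Prop. 6.33, Example 6.36, §6.6, §6.10.2, §9.1 (held copy, read first-hand).
-/

noncomputable section

open MeasureTheory Finset
open scoped RealInnerProductSpace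

namespace Literature.MathematicalPhysics.QuantumFieldTheory

open Literature.Probability.LatticeModels

section ONModelProof

variable {d N : ℕ}

/-- The spin coordinate `s ↦ (s x)_i` is measurable. [folklore] -/
private theorem measurable_coord (x : Site d) (i : Fin N) :
    Measurable fun s : ONConfig (Site d) N => (s x : EuclideanSpace ℝ (Fin N)) i := by
  have h : Continuous fun s : ONConfig (Site d) N => (s x : EuclideanSpace ℝ (Fin N)) :=
    (continuous_apply x).subtype_val
  have h2 : Continuous fun s : ONConfig (Site d) N =>
      (EuclideanSpace.proj i : EuclideanSpace ℝ (Fin N) →L[ℝ] ℝ) (s x : EuclideanSpace ℝ (Fin N)) :=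
    (EuclideanSpace.proj i).continuous.comp h
  exact h2.measurable

/-- `|(s x)_i| ≤ 1` for a unit spin. [folklore] -/
private theorem abs_coord_le (s : ONConfig (Site d) N) (x : Site d) (i : Fin N) :
    |(s x : EuclideanSpace ℝ (Fin N)) i| ≤ 1 := by
  have h := PiLp.norm_apply_le (s x : EuclideanSpace ℝ (Fin N)) i
  rw [Real.norm_eq_abs] at h
  exact h.trans (by simp)

/-- The two-point function as a sum over coordinates of expectations of products:
`⟨s_x · s_y⟩_μ = ∑_i ∫ (s x)_i (s y)_i dμ` (Friedli–Velenik 2017, §9.1). [folklore] -/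
private theorem onTwoPoint_eq_sum (μ : Measure (ONConfig (Site d) N)) [IsFiniteMeasure μ]
    (x y : Site d) :
    onTwoPoint μ x y = ∑ i, ∫ s, (s x : EuclideanSpace ℝ (Fin N)) i *
      (s y : EuclideanSpace ℝ (Fin N)) i ∂μ := by
  rw [onTwoPoint, ← integral_finsetSum]
  · refine integral_congr_ae (ae_of_all _ fun s => ?_)
    simp [PiLp.inner_apply, mul_comm]
  · intro i _
    exact (integrable_of_abs_le (measurable_coord x i) (fun s => abs_coord_le s x i)).mul_bdd
      (measurable_coord y i).aestronglyMeasurable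
      (ae_of_all _ fun s => by rw [Real.norm_eq_abs]; exact abs_coord_le s y i)

/-- **Discharge of `onTwoPoint_decay_high_temperature`** (Dobrushin 1968; Georgii 2011, Thm. 8.7
with Example 8.11 and Cor. 8.32; Friedli–Velenik 2017, Thm. 6.26, Thm. 6.31, §6.10.2, §9.1): for
every `N ≥ 1` and `d`, with `β₀ = ¼ log (1 + 1/(2d+1)) > 0`, for all `0 < β < β₀` the O(N) model
on `ℤ^d` has exactly one Gibbs measure (existence by compactness and the Feller property,
uniqueness by Dobrushin's criterion `2d (e^{4β} - 1) < 1`), and its two-point function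
`⟨s_0 · s_x⟩` decays exponentially: `|⟨s_0 · s_x⟩| ≤ 6N e^{-m‖x‖_∞}` with
`m = -log (2d (e^{4β} - 1))` (covariance estimate by comparison with a local tilt, plus
`⟨(s x)_i⟩ = 0` by `O(N)`-invariance of the unique Gibbs measure).
[cite: Georgii2011, Ch. 8 Thm. 8.7 with Example 8.11 and Cor. 8.32] [cite: FriedliVelenik2017, Thm. 6.31 with Thm. 6.26] -/
theorem onTwoPoint_decay_high_temperature_holds : onTwoPoint_decay_high_temperature := by
  intro d N _
  obtain ⟨β₀, hβ₀, hU⟩ := exists_hasUniqueGibbsMeasure_onSpecification_zd (N := N) d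
  -- shrink the window to the explicit one so that the covariance rate is available
  refine ⟨min β₀ (Real.log (1 + 1 / (2 * d + 1)) / 4), lt_min hβ₀ ?_, fun β hβ => ?_⟩
  · have hd : (0 : ℝ) < 2 * d + 1 := by positivity
    have h1 : (1 : ℝ) < 1 + 1 / (2 * d + 1) := by have := one_div_pos.2 hd; linarith
    have := Real.log_pos h1
    linarith
  have hβpos : 0 < β := hβ.1
  have hβ₀' : β < β₀ := hβ.2.trans_le (min_le_left _ _)
  have hβw : |β| < Real.log (1 + 1 / (2 * d + 1)) / 4 := by
    rw [abs_of_pos hβpos]; exact hβ.2.trans_le (min_le_right _ _)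
  have hUβ : HasUniqueGibbsMeasure (onSpecification (N := N) (zdGraph d) β) := hU β ⟨hβpos, hβ₀'⟩
  refine ⟨hUβ, fun μ hμ => ?_⟩
  have hμ' : IsGibbsMeasure (onSpecification (zdGraph d) β) μ := hμ
  haveI := hμ'.isProbabilityMeasure
  have hc1 : ((2 * d : ℕ) : ℝ) * onDobrushinCoeff β < 1 := two_d_mul_onDobrushinCoeff_lt_one d hβw
  -- means vanish by `O(N)`-symmetry of the unique Gibbs measure
  have hmean : ∀ (y : Site d) (i : Fin N), ∫ s, (s y : EuclideanSpace ℝ (Fin N)) i ∂μ = 0 :=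
    fun y i => integral_spinCoord_eq_zero_of_subsingleton (zdGraph d) β hUβ.1 hμ' y i
  rcases Nat.eq_zero_or_pos d with hd0 | hdpos
  · -- `d = 0`: the lattice is a single point, `‖x‖ = 0`, and `|⟨s_0 · s_x⟩| ≤ 1`
    subst hd0
    refine ⟨1, 1, one_pos, fun x => ?_⟩
    have hx : x = 0 := Subsingleton.elim _ _
    subst hx
    show |onTwoPoint μ (0 : Site 0) 0| ≤ 1 * Real.exp (-1 * ‖(0 : Site 0)‖)
    rw [norm_zero, mul_zero, Real.exp_zero, mul_one]
    exact abs_onTwoPoint_le_one μ 0 0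
  · -- `d ≥ 1`: `0 < c < 1`, rate `m = -log c`
    have hc0 : 0 < ((2 * d : ℕ) : ℝ) * onDobrushinCoeff β := by
      have hC : 0 < onDobrushinCoeff β := by
        unfold onDobrushinCoeff
        have : 0 < 4 * |β| := by rw [abs_of_pos hβpos]; linarith
        have := Real.one_lt_exp_iff.2 this
        linarith
      have hd' : (0 : ℝ) < ((2 * d : ℕ) : ℝ) := by exact_mod_cast Nat.mul_pos two_pos hdpos
      exact mul_pos hd' hC
    set m : ℝ := -Real.log (((2 * d : ℕ) : ℝ) * onDobrushinCoeff β) with hm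
    have hmpos : 0 < m := by
      rw [hm, neg_pos]
      exact Real.log_neg hc0 hc1
    refine ⟨6 * N, m, hmpos, fun x => ?_⟩
    show |onTwoPoint μ (0 : Site d) x| ≤ 6 * N * Real.exp (-m * ‖x‖)
    rw [onTwoPoint_eq_sum]
    have hterm : ∀ i : Fin N, |∫ s, (s (0 : Site d) : EuclideanSpace ℝ (Fin N)) i *
        (s x : EuclideanSpace ℝ (Fin N)) i ∂μ| ≤ 6 * Real.exp (-m * ‖x‖) := fun i => by
      have h := abs_covariance_spin_le_exp (N := N) d hc0 hc1 hμ' 0 x i i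
      rw [hmean 0 i, hmean x i, mul_zero, sub_zero, sub_zero] at h
      simpa [hm] using h
    calc |∑ i, ∫ s, (s (0 : Site d) : EuclideanSpace ℝ (Fin N)) i *
            (s x : EuclideanSpace ℝ (Fin N)) i ∂μ|
        ≤ ∑ i, |∫ s, (s (0 : Site d) : EuclideanSpace ℝ (Fin N)) i *
            (s x : EuclideanSpace ℝ (Fin N)) i ∂μ| := Finset.abs_sum_le_sum_abs _ _
      _ ≤ ∑ _i : Fin N, 6 * Real.exp (-m * ‖x‖) := Finset.sum_le_sum fun i _ => hterm i
      _ = 6 * N * Real.exp (-m * ‖x‖) := by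
          rw [Finset.sum_const, Finset.card_univ, Fintype.card_fin, nsmul_eq_mul]; ring

end ONModelProof

end Literature.MathematicalPhysics.QuantumFieldTheory
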